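import Summits.QuantumFields.YangMills.Theorems.BalabanUVNodesN16OfLeaf
import Summits.QuantumFields.YangMills.Theorems.BalabanUVNodesN16HolderMSPrintOfLeaf
import HarnessLib

/-!
# Route «BalabanUVNodes», cluster K4 «SpineRates» — node N16 = NE3: AT `η = L^{−k}` ON MATRICES, THE LEAF CLAUSES GIVE THE `ℤᵈ` READING (T4^ℤᵈ_print-MS) WITH
# THE (1.36)₃ LINE MULTI-SCALE (repair R-β″, PRODUCER HALF, (R6) part 2; twin of generation 0's file 5 §2 `N16.OfLeaf.thm4TorusAt_print_of_leaf`)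

Cell `pub-ymgap`, seat `pub-ymgap-dag-n16-c` (R134 fan-out seat, strategy s1; HUMAN RULING D-0062; chair R424 venue), generation 4, file 34.
`--supports stmt-QuantumFields-19912 --as helper` (K3‴ `SpineGivenEndpointR13`, route rev 16).  `bears_on: R4∕N16 · edge N05 → N16`.  Located item:
`HOME/pub-ymgap-dag-n16-c/LOCATED-N16-HOLDER-PIN.md`, census row R-β″ (ADDENDUM 5).  Over file 33 `N16HolderMSPrintOfLeaf`; consumer: file 32
`N16HolderMSTorusOfZd.thm4TorusAt_printMS_of_zd` (its hypothesis `hT` is this file's conclusion), then files 31 → 29 → 30 → 25∕28 → `CovRootHolderMS`.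

WHY.  Generation 0's file 5 §2 turns file 4b's conclusion slot `Concl_P` (leaf letters: weights `(Lᵏη)^{−·}`, the (1.36)₃ line at admissible nearest-neighbour
pairs with transport `R(U₀(y,μ))`) into file 2's (T4^ℤᵈ_print) slot at `η = L^{−k}` by a pointwise `Iff` (`thm4TorusAt_concl_congr`): `Lᵏη = 1` kills the
weights and `(y, y + e_μ)` is admissible (`len e_μ = 1`).  For the multi-scale slots the same `Iff` holds under the LENGTH LETTER «`len (j•e_μ) = j` for every
`j : ℕ`» (print's |·| on ηℤᵈ; the tree's `l1Len` ∕ `euclidLen`): then `(y, y + j•e_μ)` is admissible iff `1 ≤ j ≤ L^k`, `(η·len(j•e_μ))^β = (ξ^k)^β·j^β`, and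
`R(U₀(Γ_{y,y+j e_μ})) = conjR (hol U₀ y (seg μ j)) = Ad (hol U₀ y (seg μ j))` (rfl).  So file 33's `Concl_P-MS` at `η = L^{−k}` IS file 32's slot.

WHAT THIS FILE PROVES (kernel, theorems only, 0 `def`, 0 sorry): `thm4TorusAt_printMS_of_leaf` (twin of g0's `thm4TorusAt_print_of_leaf` with the length letter
`hlenj : ∀ μ j, len (j • e μ) = j` in place of `len (e μ) = 1`).
HONEST FRAMING: bookkeeping; the leaf clauses are node N05's theorems (in the tree modulo its sockets); N16 ∕ NE3 NOT discharged; count-neutral; one finite four-torus at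
fixed ε — NOT ℝ⁴, NOT infinite volume, NOT OS, NOT a mass gap, NOT Clay.
-/

set_option autoImplicit false

open scoped BigOperators Matrix Matrix.Norms.L2Operator
open NormedSpace

namespace Summit.QuantumFields.YangMills.BalabanUVNodes.N16HolderMSOfLeaf

open Literature.MathematicalPhysics.QuantumFieldTheory.Balaban1983to89
open B7Prop1Explicit B7Prop2Explicit
open B7Prop3Flat (c3)
open B7Eq78Linearization (conjR)
open B7Eq92Concrete (mgauge)
open B8Ineq132 (InAk covDerivFwd)
open B8Eq184Proof (cfgExp)
open B8Eq119TwistedAxial (Restr129)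
open B8Eq138LandauZd (IsLandau138 covLap)
open B9Eq340HolderZd (AdmPair mem_admPair)
open B8Thm4TorusAt (torusLam Thm4TorusAt)
open B8LeafModelZd (ZdIdx)
open B8LeafModelZd3 (zdGF3)
open Summit.QuantumFields.BalabanUV.T4Continuum
open T4AveragingDeficitWall (Ad)
open MinimalActionClassSix (conjR_eq_Ad)
open N16.OfLeaf (thm4TorusAt_concl_congr)
open N16HolderMSPrintOfLeaf (thm4TorusAt_zero_printMS_of_leaf_univ)

noncomputable section

variable {d : ℕ}

section Matrices

variable {n : Type} [Fintype n] [DecidableEq n]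

/-- **THE LEAF CLAUSES ⟹ (T4^ℤᵈ_print-MS), VERBATIM** (`𝔸 = M_n(ℂ)`; `d, L ≥ 2`; Hölder data `β ≥ 0`, `len ≥ 1` on its support and the length letter
`len (j•e_μ) = j`; constants and window as in file 33): `B8.Thm4Body c₁ B₁′` and `B8.Prop3Body cP d L C₂ inp B₀β` on `fun i ↦ zdGF3 (M_n(ℂ)) L β len i.1` over
`{i // i.Ω 0 = univ}` give, at EVERY `k ≥ 1` and for every `Reg`, `Thm4TorusAt L k 0 (Lᵏ)⁻¹ c₁′ unitaryUnits Reg (Restr129 L k (torusLam k)) Concl⁰_print-MS` with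
`B = 5dLB₀`, `B_h = 5dLB₀(β₀)` and the (1.36)₃ line «`‖Ad (hol U₀ y (seg μ j)) (D A_κ)(y+j•e_μ) − (D A_κ)(y)‖ ≤ B_h(α₀+α₁)·((L⁻¹)^k)^β·j^β`, `1 ≤ j ≤ L^k`» — file 33
at `η = L^{−k}` (`Lᵏη = 1`; `(y, y + j•e_μ)` admissible iff `1 ≤ j ≤ L^k`; `conjR = Ad`).
[cite: Balaban1985RegularSpaces, Thm 4 p.88, Prop. 3 p.87, (1.36)–(1.39) pp.82–83, p.77 («Ω_j = T_η»); Balaban1985BackgroundPropagators, (3.40) p.397] -/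
theorem thm4TorusAt_printMS_of_leaf [Nonempty n] (hd2 : 2 ≤ d) {L : ℕ} (hL : 2 ≤ L) {β : ℝ} (hβ : 0 ≤ β) {len : Site d → ℝ}
    (hlen : ∀ v : Site d, 0 < len v → 1 ≤ len v) (hlenj : ∀ (μ : Fin d) (j : ℕ), len (j • e μ) = j) {c₁ c₁' B₁' cP C₂ B₀β : ℝ} {inp : B8.B9Inputs}
    (hB₁' : 0 < B₁') (hBB : 5 * (d : ℝ) * L * inp.B₀ ≤ B₁')
    (hwin : ∀ α₀ α₁ : ℝ, 0 < α₀ → 0 < α₁ → α₀ + α₁ ≤ c₁' →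
      α₀ + α₁ ≤ c₁ ∧ C0 d * (2 * α₀) ≤ 1 / 3 ∧ 4 * α₀ ≤ c2' d L ∧ 16 * (B₁' * (α₀ + α₁)) ≤ 1 ∧
      Real.exp (4 * (800 * ((d : ℝ) + 1) ^ 2 * ((d : ℝ) + 4)) * α₀) * (1 + 8 * (131072 * ((d : ℝ) + 1) ^ 2) * (B₁' * (α₀ + α₁))) ≤ 2 ∧
      2 * (B₁' * (α₀ + α₁)) ≤ c3 d L ∧ (d : ℝ) * L * α₁ ≤ 1 / 8 ∧ α₀ ≤ cP ∧ α₁ ≤ cP ∧ B₁' * (α₀ + α₁) ≤ cP ∧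
      2 * (B₁' * (α₀ + α₁)) ^ 2 + 20 * d * α₀ * (B₁' * (α₀ + α₁)) + 2 * C₂ * (B₁' * (α₀ + α₁)) ^ 2 ≤ α₀ + α₁)
    (Reg : ℕ → (Site d → Fin d → (Matrix n n ℂ)ˣ) → Prop) :
    letI : CStarAlgebra (Matrix n n ℂ) := {}
    B8.Thm4Body c₁ B₁' (fun i : {i : ZdIdx d L // i.Ω 0 = Set.univ} => (zdGF3 (Matrix n n ℂ) L β len i.1).toGFData) →
    B8.Prop3Body cP d (L : ℝ) C₂ inp B₀β (fun i : {i : ZdIdx d L // i.Ω 0 = Set.univ} => (zdGF3 (Matrix n n ℂ) L β len i.1).toGFData2) →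
    ∀ k, 1 ≤ k → Thm4TorusAt L k 0 (((L : ℝ) ^ k)⁻¹) c₁' (unitaryUnits (Matrix n n ℂ)) (Reg k) (Restr129 L k (torusLam k))
      (fun (α₀ α₁ : ℝ) (U₀ U' : Site d → Fin d → (Matrix n n ℂ)ˣ) (u : Site d → (Matrix n n ℂ)ˣ) =>
        ∃ A : Site d → Fin d → Matrix n n ℂ,
          (∀ x μ, IsSelfAdjoint (A x μ)) ∧ mgauge U₀ u (cfgExp (((L : ℝ) ^ k)⁻¹) A) = U' ∧
          (∀ x μ, ‖A x μ‖ ≤ 5 * (d : ℝ) * L * inp.B₀ * (α₀ + α₁)) ∧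
          (∀ (μ : Fin d) (x : Site d) (κ : Fin d),
            ‖covDerivFwd (((L : ℝ) ^ k)⁻¹) U₀ μ (fun z => A z κ) x‖ ≤ 5 * (d : ℝ) * L * inp.B₀ * (α₀ + α₁)) ∧
          IsLandau138 L k (((L : ℝ) ^ k)⁻¹) Set.univ (torusLam k) U₀ A ∧
          (∀ (κ μ : Fin d) (y : Site d) (j : ℕ), 1 ≤ j → j ≤ L ^ k →
            ‖Ad (hol U₀ y (seg μ (j : ℤ))) (covDerivFwd (((L : ℝ) ^ k)⁻¹) U₀ μ (fun z => A z κ) (y + j • e μ))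
                - covDerivFwd (((L : ℝ) ^ k)⁻¹) U₀ μ (fun z => A z κ) y‖
              ≤ 5 * (d : ℝ) * L * B₀β * (α₀ + α₁) * ((((L : ℝ)⁻¹) ^ k) ^ β * (j : ℝ) ^ β)) ∧
          (∀ (x : Site d) (κ : Fin d), ‖covLap (((L : ℝ) ^ k)⁻¹) U₀ (fun z => A z κ) x‖ ≤ 5 * (d : ℝ) * L * inp.B₀ * (α₀ + α₁))) := by
  letI : CStarAlgebra (Matrix n n ℂ) := {}
  intro hT hP k hk
  have hL1 : 1 ≤ L := le_trans (by norm_num) hL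
  have hL1r : (1 : ℝ) ≤ L := by exact_mod_cast hL1
  have hLk : (1 : ℝ) ≤ (L : ℝ) ^ k := one_le_pow₀ hL1r
  have hη : 0 < ((L : ℝ) ^ k)⁻¹ := by positivity
  have hη1 : ((L : ℝ) ^ k)⁻¹ ≤ 1 := inv_le_one_of_one_le₀ hLk
  have h := thm4TorusAt_zero_printMS_of_leaf_univ hd2 hL hβ hlen hB₁' hBB hwin hT hP hk hη (Reg k)
  refine thm4TorusAt_concl_congr (fun α₀ α₁ U₀ U' u => ?_) h
  -- the letter identities at `η = L^{-k}`
  have hLk0 : (0 : ℝ) < (L : ℝ) ^ k := by positivity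
  have hw : (L : ℝ) ^ k * ((L : ℝ) ^ k)⁻¹ = 1 := mul_inv_cancel₀ hLk0.ne'
  have hw2 : ((L : ℝ) ^ k * ((L : ℝ) ^ k)⁻¹) ^ (-(2 : ℝ)) = 1 := by rw [hw, Real.one_rpow]
  have hw3 : ((L : ℝ) ^ k * ((L : ℝ) ^ k)⁻¹) ^ (-(3 : ℝ)) = 1 := by rw [hw, Real.one_rpow]
  have hwβ : ((L : ℝ) ^ k * ((L : ℝ) ^ k)⁻¹) ^ (-(2 + β)) = 1 := by rw [hw, Real.one_rpow]
  have hηβ : ∀ (μ : Fin d) (j : ℕ), (((L : ℝ) ^ k)⁻¹ * len (j • e μ)) ^ β = (((L : ℝ)⁻¹) ^ k) ^ β * (j : ℝ) ^ β := fun μ j => by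
    rw [hlenj μ j, inv_pow, Real.mul_rpow (by positivity) (Nat.cast_nonneg j)]
  -- admissibility of the line pair `(y, y + j•e_μ)` iff `1 ≤ j ≤ L^k`
  have hadm : ∀ (μ : Fin d) (y : Site d) (j : ℕ), 1 ≤ j → j ≤ L ^ k → (y, y + j • e μ) ∈ AdmPair (((L : ℝ) ^ k)⁻¹) len := by
    intro μ y j hj hjL
    rw [mem_admPair]
    simp only [add_sub_cancel_left, hlenj μ j]
    refine ⟨by exact_mod_cast hj, ?_⟩
    have hjr : (j : ℝ) ≤ (L : ℝ) ^ k := by exact_mod_cast hjL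
    rw [← div_eq_inv_mul, div_le_one hLk0]
    exact hjr
  have hadm' : ∀ (μ : Fin d) (y : Site d) (j : ℕ), (y, y + j • e μ) ∈ AdmPair (((L : ℝ) ^ k)⁻¹) len → 1 ≤ j ∧ j ≤ L ^ k := by
    intro μ y j hp
    rw [mem_admPair] at hp
    simp only [add_sub_cancel_left, hlenj μ j] at hp
    obtain ⟨hp1, hp2⟩ := hp
    refine ⟨by exact_mod_cast hp1, ?_⟩
    rw [← div_eq_inv_mul, div_le_one hLk0] at hp2
    exact_mod_cast hp2
  constructor
  · rintro ⟨A, h1, h2, h3, h4, h5, h6, h7⟩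
    refine ⟨A, h1, h2, fun x μ => ?_, fun μ x κ => ?_, h5, fun κ μ y j hj hjL => ?_, fun x κ => ?_⟩
    · have h := h3 x μ; rwa [hw, inv_one, mul_one] at h
    · have h := h4 μ x κ; rwa [hw2, mul_one] at h
    · have h := h6 κ μ y j (hadm μ y j hj hjL); rwa [hwβ, mul_one, hηβ μ j] at h
    · have h := h7 x κ; rwa [hw3, mul_one] at h
  · rintro ⟨A, h1, h2, h3, h4, h5, h6, h7⟩
    refine ⟨A, h1, h2, fun x μ => ?_, fun μ x κ => ?_, h5, fun κ μ y j hp => ?_, fun x κ => ?_⟩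
    · rw [hw, inv_one, mul_one]; exact h3 x μ
    · rw [hw2, mul_one]; exact h4 μ x κ
    · obtain ⟨hj, hjL⟩ := hadm' μ y j hp
      rw [hwβ, mul_one, hηβ μ j]; exact h6 κ μ y j hj hjL
    · rw [hw3, mul_one]; exact h7 x κ

end Matrices

end

end Summit.QuantumFields.YangMills.BalabanUVNodes.N16HolderMSOfLeaf
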